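import Summits.ResolutionOfSingularities.ResolutionOfSingularities.Theorems.FrobeniusClosingPatchingRelPerfectDepthFlagTargets
import Summits.ResolutionOfSingularities.ResolutionOfSingularities.Theorems.FrobeniusClosingPatchingRelPerfectDepthTargetsWeightedDefs
import Summits.ResolutionOfSingularities.ResolutionOfSingularities.Theorems.FrobeniusClosingPatchingRelPerfectDepthWeightTwoBState
import Literature.AlgebraicGeometry.Resolution.StrictNormalCrossings
import HarnessLib

/-!
# Chain W5.2 — «F6» stage 1, the residual `LegalScopedDivisorReduction₃`: PHASE TARGETS of record
# (phase 1 «CJS truncated at the first regular stage» · phase 2 «make the support snc, legally» · phase 3 «monomial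
# clean-up = peels + separation»), in the ONE-IDEAL currency `IsPureWeightedSeq 2`

[OURS · L1 W5.2 · res-L1-w52-idea-1 gen 7 = OWNER of the `LegalScopedDivisorReduction₃` design (res-L1-w52-plan-1 RULING
R3 (b) / STEER 5 (3)); OWNER RULING O1 2026-08-27T11:55:07Z; hands: phase 1 = res-type-049, phase 2 = res-D-pv-016 (2a,
CONDITIONAL on an F-60♯-shaped inline binder) ‖ res-L1-w52-lead-1 (2b, fact-free separation game), phase 3 = res-L1-w52-lead-1
BY NAME (`weightedCleanupSNC_holds 2`)]  NOT statements of the manuscript under review (Hironaka 2017); AI-typed, weaker than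
expert review.  DEFINITIONS ONLY and FACT-FREE.  The PROVED composition
`LegalPhaseOne₃ → LegalPhaseTwo₃ → LegalScopedDivisorReduction₃` (phase 3 discharged BY NAME) is the sibling
`…DepthFlagLegalPhasesGlue`, where moreover `LegalPhaseOne₃` is CLOSED modulo the OURS binder `SingCentres₃` (F-32♯a) by
res-type-049's `WeightTwoB.legalPhaseOne_of_truncated`; so the residual of record is the PAIR ⟨`SingCentres₃`, `LegalPhaseTwo₃`⟩.

THE CUT (all sequences are PURE WEIGHT-TWO sequences `IsPureWeightedSeq 2 ρ H H'` of the ONE ideal `H` — every centre regular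
with `H_k ≤ 𝓘_C²`, i.e. inside `{ord H_k ≥ 2}`; conversion to the diagonal flag `IsFlagSeq ρ H H H' H'` and to `EndFlag` happens
once, in the glue; the running state is plan-1's `FlagState₃ E H H`):
* `LegalPhaseOne₃` — from a REDUCED divisor (`FlagScope H H`: no multiple component) reach `HostBoundary₃` = THE HANDS' OWN
  CURRENCY `WeightTwoB.StateIn H' D' ℬ' [] ∧ Scheme.IsRegular D'.subscheme` (res-D-pv-054 / res-type-049, `…DepthWeightTwoBState`):
  `H' = D' · monomialIdeal ℬ'` with `D'` a REGULAR reduced effective Cartier host (the strict transform of `V(H)`), `ℬ'` an snc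
  list of irreducible boundary components with exponents (the exceptional components, multiplicities `ord − 2 ≥ 0`), none
  inside the host (rev 3: both the producer res-type-049 `legalPhaseOne_of_truncated` and the consumer res-D-pv-016 work in
  `StateIn`, so the interface IS `StateIn`; the charged list `𝒟` is dropped — `StateIn H D ℬ 𝒟 → StateIn H D ℬ []` is field-wise).
  Intended closer (res-type-049 `cjs_pure_transport` / `legalPhaseOne_of_truncated`, tree `…DepthLegalPieces`/`…DepthLegalCJS`,
  + the glue's `isReduced_subscheme_of_flagScope`): transport along the
  Cossart–Jannsen–Saito canonical sequence TRUNCATED AT THE FIRST REGULAR STAGE, whose centres lie in `Sing(X_k)` (typing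
  request F-32♯a; the tree's old per-step predicate `IsBPermissibleSequence (Supp H) ∅`), hence at points of host order `≥ 2`:
  LEGAL.  CONDITIONAL on an inline F-32♯a-shaped binder, which res-dag-4 (FACT RULING F-32♯ 2026-08-27T12:01:38Z) ruled an
  OURS STATEMENT (not a printed assertion): for INTEGRAL `H` it is a kernel corollary (size M) of the admissible CONSTRUCTION
  fact F-72 (the canonical sequence = iterated Σ^{O,max}-eliminations); for REDUCIBLE reduced `H` the truncation argument is
  UNSOUND as stated (components regularise at different stages and a regular component then receives boundary blow-ups with
  centres in `Reg`, res-lit-3; witness `V(y,z) ∪ V(x, w² − y⁵ − z⁵)`), so the reducible case of the binder is OPEN (candidate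
  repair: a component-frozen re-run of CJS Cor. 6.26, size L) — THIS IS THE PHASE-1 RISK OF RECORD.
* `LegalPhaseTwo₃` — from `HostBoundary₃` reach `SncSupport` (`Supp H'' ⊆` an snc divisor) legally.  Closers raced:
  (2a) res-D-pv-016, CONDITIONAL on an inline F-60♯-shaped binder = CJS with INITIAL boundary `O := Supp M` (the
  POSITIVE-multiplicity components only; NOT CJS's full exceptional boundary: a multiplicity-zero exceptional `F` gives
  O-permissible centre points on `X ∩ F` of order `1`), every centre point on the STRICT transform of the initial boundary ⇒
  on the regular host AND on an old positive component ⇒ order `≥ 2`: LEGAL (res-dag-4 12:01:38Z (3): an OURS binder — worded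
  with the STRICT transform of the INITIAL boundary — or a kernel corollary of F-72, since the host is regular); (2b)
  res-L1-w52-lead-1, FACT-FREE separation game (host regular vs snc positive boundary, centres inside `X ∩ Supp M`,
  multiplicity bookkeeping `e_G = ord_C H − 2`).  Multiplicity-zero exceptionals are NOT in `Supp H` and never matter.
* `LegalSeparation₃` / `LegalSeparationPure₃` — from `SncSupport` reach order `≤ 1` everywhere: Kollár (3.111) Step 3 on the
  monomial presentation = PEEL the components of multiplicity `≥ 2`, then SEPARATE intersecting components along the strata;
  BY NAME `weightedCleanupSNC_holds 2` (res-D-pv-054, tree `…DepthWeightedCleanupSNC`).  Peeling is NOT a separate phase.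
WHY IT MIGHT FAIL (the residual's risk lives in phases 1–2): phase 1 needs a sequence with EVERY centre in the singular locus
of the host, ending regular with snc exceptionals — sound for integral `H` (F-72 corollary), OPEN for reducible reduced `H`
(see `LegalPhaseOne₃`); phase 2 needs either the F-60♯-shaped OURS binder (O-permissibility w.r.t. the PRESCRIBED initial
boundary `Supp M`) or the fact-free game; the A₂ witness `H = V(xy − z³)` shows that the black-box forms F-32bR / F-60 AS
TYPED (`IsBPermissibleSequenceB`, complete-transform boundary) do NOT suffice (second-cycle centres through order-one points).

## References
* V. Cossart, U. Jannsen, S. Saito, *Desingularization: invariants and strategy*, LNM 2270 (2020), Thm. 1.3–1.4, Def. 4.1,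
  Thm. 5.9. [CossartJannsenSaito2020]
* J. Kollár, *Lectures on Resolution of Singularities* (2007), (3.111) Step 3. [Kollar2007]
* E. Bierstone, D. Grigoriev, P. Milman, J. Włodarczyk (2011), §3.2, §4 Step 2b. [BierstoneGrigorievMilmanWlodarczyk2011]
-/

-- `Summit.<Summit>.<Sub>.Theorems` with `Sub = Summit` (single-conjunct summit, D-0017)
set_option linter.dupNamespace false

noncomputable section

open CategoryTheory CategoryTheory.Limits AlgebraicGeometry TopologicalSpace
open Literature.AlgebraicGeometry.Resolution
open Scheme.IdealSheafData

namespace Summit.ResolutionOfSingularities.ResolutionOfSingularities.Theorems.DepthTargets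

universe u

/-- [OURS · L1 W5.2] **snc SUPPORT**: the support of `H` lies in a strict normal crossings divisor of `E` (the input shape of
`WeightedCleanupSNC`).  NOT a statement of the manuscript.
(cf. Kollár 2007 = bib Kollar2007, (3.111) Step 3 — OURS node; pointer in prose) -/
def SncSupport (E : Scheme.{u}) (H : E.IdealSheafData) : Prop :=
  ∃ B : Set E, IsStrictNormalCrossingsDivisor E B ∧ (H.support : Set E) ⊆ B

/-- [OURS · L1 W5.2] **HOST × BOUNDARY state** (output of phase 1, input of phase 2), in the hands' currency: the T5-E transport
state `WeightTwoB.StateIn H D ℬ []` (`H = D · monomialIdeal ℬ`, `D` a reduced effective Cartier HOST, `ℬ` an snc list of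
irreducible boundary components none of which lies inside the host; no charged components) with the host REGULAR.  The host
need NOT be normal crossings with the boundary — making `Supp H` snc, legally, is phase 2.  NOT a statement of the manuscript.
(cf. Cossart–Jannsen–Saito 2020 = bib CossartJannsenSaito2020, Thm. 1.4 (setup `B`, no component of `X` in `B`) — OURS
node; pointer in prose) -/
def HostBoundary₃ (E : Scheme.{u}) [IsNoetherian E] (H : E.IdealSheafData) : Prop :=
  ∃ (D : E.IdealSheafData) (ℬ : List (E.IdealSheafData × ℕ)), WeightTwoB.StateIn H D ℬ [] ∧ Scheme.IsRegular D.subscheme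

/-- [OURS · L1 W5.2] **THE PHASE-1 BINDER `SingCentres₃` (chain label F-32♯a) — an OURS STATEMENT, not a Literature fact**
(res-dag-4 FACT RULING F-32♯ 2026-08-27T12:01:38Z (1)(c): «file it in idea-1's targets module as a conditional binder»): for a
non-zero locally principal REDUCED `H` on an integral Noetherian regular excellent threefold `E`, SOME finite sequence of blowings
up in regular centres lying in the singular loci of the successive strict transforms of `Supp H`, normal crossings with the
accumulated exceptional boundary (the tree's per-step predicate `IsBPermissibleSequence (Supp H) ∅`), ends with a REGULAR reduced
strict transform.  = res-type-049's inline hypothesis `htr` of `WeightTwoB.legalPhaseOne_of_truncated` (p-landed `…DepthLegalCJS`),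
quantified.  STATUS: for INTEGRAL `H` a kernel corollary-to-be of the admissible CONSTRUCTION fact F-72 (CJS canonical sequence =
iterated Σ^{O,max}-eliminations; typer res-lit-6); for REDUCIBLE `H` by FREEZE-AND-RESTART at the first regular connected
component (res-L1-w52-plan-1 R4 (3), owner O2.2: hypersurface ⇒ the `H_X`-first lex-max stratum of a singular component lies in
`{ord ≥ 2}`; frozen components are clopen and disjoint from all later centres) — OPEN until that corollary lands; plain truncation
of the canonical sequence is REFUTED in class by `H = z(x² − z⁵)` (res-lit-3 §4.4).  NOT a statement of the manuscript; NOT a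
printed assertion of [CJS] (stronger than Thm 6.9 (a) as printed).
(cf. Cossart–Jannsen–Saito 2020 = bib CossartJannsenSaito2020, Thm. 6.9, Cor. 6.26, Def. 6.23, Lemma 2.31 — OURS node; pointer
in prose, the Prop being parameterless) -/
def SingCentres₃ : Prop :=
  ∀ (E : Scheme.{u}) [IsIntegral E] [IsNoetherian E], Scheme.IsRegular E → Scheme.IsExcellent E →
    topologicalKrullDim E = 3 →
    ∀ (H : E.IdealSheafData), H ≠ ⊥ → IsLocallyPrincipal H → IsReduced H.subscheme →
      ∃ (Z₁ : Scheme.{u}) (π : Z₁ ⟶ E) (X₁ B₁ : Set Z₁),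
        IsBPermissibleSequence (H.support : Set E) (∅ : Set E) π X₁ B₁ ∧
        Scheme.IsRegular (vanishingIdeal ⟨closure X₁, isClosed_closure⟩).subscheme

/-- [OURS · L1 W5.2] **TARGET `LegalPhaseOne₃` — CJS first cycle, truncated at the first regular stage, LEGALLY**: from a
non-zero locally principal REDUCED `H` (`FlagScope H H`) on an integral Noetherian regular excellent threefold, a pure
weight-two sequence to a `HostBoundary₃` state.  Hand: res-type-049 (CONDITIONAL on an inline F-32♯a-shaped OURS binder
`∃ Z₁ π X₁ B₁, IsBPermissibleSequence (Supp H) ∅ π X₁ B₁ ∧ X₁ regular ∧ B₁ snc ∧ …`).  Why it might fail: the binder is a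
theorem-to-be for INTEGRAL `H` only (kernel corollary of F-72); for REDUCIBLE reduced `H` (allowed by `FlagScope H H`) the CJS
truncation is unsound (res-dag-4 / res-lit-3 12:01:38Z) and the binder is an OPEN OURS statement.  NOT a statement of the
manuscript.
(cf. Cossart–Jannsen–Saito 2020 = bib CossartJannsenSaito2020, Thm. 1.3, Thm. 5.9 (a) — OURS node; pointer in prose, the Prop
being parameterless) -/
def LegalPhaseOne₃ : Prop :=
  ∀ (E : Scheme.{u}) [IsNoetherian E] (H : E.IdealSheafData), FlagState₃ E H H → FlagScope H H →
    ∃ (E' : Scheme.{u}) (_ : IsNoetherian E') (ρ : E' ⟶ E) (H' : E'.IdealSheafData),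
      IsPureWeightedSeq 2 ρ H H' ∧ FlagState₃ E' H' H' ∧ HostBoundary₃ E' H'

/-- [OURS · L1 W5.2] **TARGET `LegalPhaseTwo₃` — make the support snc, LEGALLY**: from a `HostBoundary₃` state a pure
weight-two sequence to an `SncSupport` state.  Hands (raced): res-D-pv-016 (CONDITIONAL on an inline F-60♯-shaped binder,
initial boundary `O := Supp M`), res-L1-w52-lead-1 (fact-free separation game).  Why it might fail: every centre must lie in
`Supp D ∩ Supp M` (order `≥ 2`); the CJS boundary form AS TYPED (F-60, `IsBPermissibleSequenceB`) allows centre points on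
multiplicity-zero exceptionals (order `1`).  NOT a statement of the manuscript.
(cf. Cossart–Jannsen–Saito 2020 = bib CossartJannsenSaito2020, Thm. 1.4, Def. 4.1 — OURS node; pointer in prose, the Prop
being parameterless) -/
def LegalPhaseTwo₃ : Prop :=
  ∀ (E : Scheme.{u}) [IsNoetherian E] (H : E.IdealSheafData), FlagState₃ E H H → HostBoundary₃ E H →
    ∃ (E' : Scheme.{u}) (ρ : E' ⟶ E) (H' : E'.IdealSheafData),
      IsPureWeightedSeq 2 ρ H H' ∧ FlagState₃ E' H' H' ∧ SncSupport E' H'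

/-- [OURS · L1 W5.2] **TARGET `LegalSeparationPure₃` — monomial clean-up in pure currency**: from an `SncSupport` state a pure
weight-two sequence to order `≤ 1` everywhere.  = `WeightedCleanupSNC 2` restricted to threefold states; CLOSED BY NAME in
the glue from res-L1-w52-lead-1's `DepthLegal.legalSeparation₃` (p529695, over `weightedCleanupSNC_holds 2` +
`IsPureWeightedSeq.transport`).  NOT a statement of the manuscript.
(cf. Kollár 2007 = bib Kollar2007, (3.111) Step 3 — OURS node; pointer in prose, the Prop being parameterless) -/
def LegalSeparationPure₃ : Prop :=
  ∀ (E : Scheme.{u}) (H : E.IdealSheafData), FlagState₃ E H H → SncSupport E H →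
    ∃ (E' : Scheme.{u}) (ρ : E' ⟶ E) (H' : E'.IdealSheafData),
      IsPureWeightedSeq 2 ρ H H' ∧ FlagState₃ E' H' H' ∧ ∀ x : E', idealOrder H' x ≤ 1

/-- [OURS · L1 W5.2] **TARGET `LegalSeparation₃` — monomial clean-up in flag currency** (res-L1-w52-lead-1's signature of
2026-08-27T11:43:36Z, the input named `SncSupport`): from a non-zero locally principal `H` with snc support on an integral
Noetherian regular excellent threefold, a flag sequence from the diagonal `(H, H)` to `EndFlag`.  CLOSED BY NAME in the glue
(`legalSeparation₃_holds`, from `LegalSeparationPure₃` via res-D-pv-016's `IsFlagSeq.of_isPureWeightedSeq` / `endFlag_self_iff`,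
p529430).  NOT a statement of the manuscript.
(cf. Kollár 2007 = bib Kollar2007, (3.111) Step 3 — OURS node; pointer in prose, the Prop being parameterless) -/
def LegalSeparation₃ : Prop :=
  ∀ (E : Scheme.{u}) [IsIntegral E] [IsNoetherian E], Scheme.IsRegular E → Scheme.IsExcellent E →
    topologicalKrullDim E = 3 →
    ∀ (H : E.IdealSheafData), H ≠ ⊥ → IsLocallyPrincipal H → SncSupport E H →
      ∃ (E' : Scheme.{u}) (ρ : E' ⟶ E) (𝔟' R₁' : E'.IdealSheafData),
        IsFlagSeq ρ H H 𝔟' R₁' ∧ FlagState₃ E' 𝔟' R₁' ∧ EndFlag 𝔟' R₁'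

end Summit.ResolutionOfSingularities.ResolutionOfSingularities.Theorems.DepthTargets

end
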